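import Mathlib
import HarnessLib
import Summits.HubbardSuperconductivity.HubbardSuperconductivity.Theses.WeakCouplingBCS
import Summits.HubbardSuperconductivity.HubbardSuperconductivity.Theses.KLProgramme
import Summits.HubbardSuperconductivity.HubbardSuperconductivity.Theorems.WeakCouplingBCSH1TwoPointLimitKLScaleDKLRegimeDoor
import Summits.HubbardSuperconductivity.HubbardSuperconductivity.Theorems.WeakCouplingBCSH1TwoPointLimitKLScaleDDopingWindowD010D025
import Summits.HubbardSuperconductivity.HubbardSuperconductivity.Theorems.KLProgrammeH10TwoPointLimitOfChildren
import Summits.HubbardSuperconductivity.HubbardSuperconductivity.Theorems.KLProgrammeKLRegimeSplitGlueV11P4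
import Summits.HubbardSuperconductivity.HubbardSuperconductivity.Theorems.KLProgrammeKLRegimeBetaSplitV11Closes
import Summits.HubbardSuperconductivity.HubbardSuperconductivity.Theorems.KLProgrammeKLRegimeTwoPointAssemblyV11Closes

/-!
# Route `WeakCouplingBCS` (ladder H3) — the door from the FIVE GEN-3 CHILDREN of crux K3 (route `KLProgramme`, bundle `klPredsV11`):
# what the registered children `KLRegimeEngineV11` · `KLRegimeBetaSplitV11` · `KLRegimeCountertermV11` · `KLRegimeVolumeLimitV11` ·
# `KLRegimeTwoPointAssemblyV11` buy on H3, BY NAME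

Cell `gate-hubbard-kl`, seat `hubbard-kl-h1-p1` gen 3 (row «R2dH1 leaf → WeakCouplingBCS/H3 consumers»; LADDER-Hubbard WORDING OF
RECORD (ii)).  Support file for the rung-R2d leaf `H1TwoPointLimitKLScaleD` (stmt-HubbardSuperconductivity-19419); companion of
`…Theorems.WeakCouplingBCSH1TwoPointLimitKLScaleD{Plumbing, Door, TypedCrux, DopingWindowD010D025, WindowedDoor, KLRegimeDoor}`.

THE POINT.  The gen-3 resplit of crux K3 `KLRegimeTwoPointLimit` (stmt-…-19937; route file rev 13–14, 2026-08-26) registers five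
children — items 19823 `KLRegimeEngineV11 := EngineP4 klPredsV11 klWindowC`, 19824 `KLRegimeBetaSplitV11 := BetaSplitP …`, 19825
`KLRegimeCountertermV11 := CountertermP2 …`, 19826 `KLRegimeVolumeLimitV11 := VolumeLimitP2 … FinalTwoLegVolLimit …`, 19827
`KLRegimeTwoPointAssemblyV11 := TwoPointAssemblyP3 … FinalTwoLegVolLimit …` — and the glue 19828 (children ⇒ K3,
`…KLRegimeSplit.KLRegimeInductionV11P4`).  The generic children are typed on the FULL multiscale range `klBetaMin ≤ β ≤ e^{c/U²}`
(no lower bound `e^{a/U} ≤ β`) and the compact-box corner `0 < β ≤ klBetaMin` is the CLOSED item R0′, so — seat p4's observation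
`…KLRegimeSplit.leaf_of_childrenP4` (generic in the bundle `Pr` and the volume-limit slot `VL`) — the five children give the
two-point limit at ALL `0 < β ≤ e^{c/U²}`: the LITERAL leaf, i.e. crux K1 AND crux K3 of `KLProgramme`, by pure logic.  This file
instantiates that at the registered gen-3 decls and composes it with every landed consumer of this lineage, so that the tribunal /
dag can read, kernel-checked and BY NAME, what closing the five children buys downstream:

  §1  children ⇒ the rung-R2d THEOREM HALF `H1TwoPointLimitKLScaleD` (and ⇒ K3, the glue, for the record).
  §2  children + window records (cert form (A): `klCertB1gWin{A,B,C}` [+ `Z`]) ⇒ the LOADED PAIR of rung R2d (by name; on the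
      extended common doping window `δ ∈ [0.10, 0.25]` with explicit `γ`).
  §3  children + cert + `hBr` [+ crux 2 `WcbcsSsbToTorusLRO` | + (D_loc)] ⇒ `HubbardSuperconductivity` / thin crux / rate-keeping
      crux / typed `WcbcsBcsConstruction` — with gen 0's `hBr` «(M_loc | normal-phase control for all β ≤ e^{c/U²})», the WEAKEST
      of the three bridge shapes ((M_loc) ⇒ `hBrKL` ⇒ `hBr` as hypotheses, `…KLRegimeDoor`), admissible here because the children
      give all temperatures;
  §4  the same four through K3 and `hBrKL` (`…KLRegimeDoor`), for comparison.

So, on H3, after the five children close: the Kohn–Luttinger input is the VERIFIED certificate half, the theorem half is a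
theorem, and the open content toward the summit `HubbardSuperconductivity` is exactly ONE research hypothesis (the relativised
(M_loc), i.e. the `h`-seeded BCS stage 2 below the Kohn–Luttinger scale) + crux 2 `WcbcsSsbToTorusLRO` [+ (D_loc) for the TYPED
crux 4 only] — unchanged by the resplit, now stated from the registered gen-3 leaves.  WHAT THIS IS NOT: no child is proved here;
nothing is asserted about the model; K1-from-children BY NAME on stmt-…-19938 is seat p4's registration (not restated); the glue
item 19828 is seat k3c2-p3's closer (used, not restated).

Sorry-free, standard axioms, no definition; the five children, the leaf, K3, crux 2, the typed crux and the summit BY NAME;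
`hBr` / `hBrKL` / (D_loc) byte-identical to `…Door` / `…KLRegimeDoor` / the registered stub of stmt-…-2010.  Sources: T. Koma,
H. Tasaki, J. Stat. Phys. 76 (1994) 745, §1; G. Benfatto, A. Giuliani, V. Mastropietro, Ann. Henri Poincaré 7 (2006) 809, Thm 1.1;
S. Raghu, S. A. Kivelson, D. J. Scalapino, Phys. Rev. B 81 (2010) 224505, §III Fig. 2.
-/

noncomputable section

-- the tree's namespace `Summit.<Summit>.<Problem>.Theorems` repeats the summit name by design (D-0017)
set_option linter.dupNamespace false

namespace Summit.HubbardSuperconductivity.HubbardSuperconductivity.Theorems.R2dH1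

open Filter Set
open Literature.MathematicalPhysics.QuantumLattice Literature.Probability.LatticeModels
open Summit.HubbardSuperconductivity.HubbardSuperconductivity.Theses.WeakCouplingBCS
  (H1TwoPointLimitKLScaleD WcbcsKohnLuttingerB1g WcbcsSsbToTorusLRO WcbcsBcsConstruction)
open Summit.HubbardSuperconductivity.HubbardSuperconductivity.Theses.KLProgramme
  (KLRegimeTwoPointLimit KLRegimeEngineV11 KLRegimeBetaSplitV11 KLRegimeCountertermV11 KLRegimeVolumeLimitV11
    KLRegimeTwoPointAssemblyV11)
open Summit.HubbardSuperconductivity.HubbardSuperconductivity.Theorems.KLRegimeSplit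
  (klPredsV11 klWindowC FinalTwoLegVolLimit leaf_of_childrenP4 KLRegimeInductionV11P4)
open scoped Topology

/-! ### §1 The five gen-3 children give the rung-R2d theorem half (and K3) -/

/-- **THE RUNG-R2d THEOREM HALF FROM THE FIVE GEN-3 CHILDREN OF K3, BY NAME.** The registered route decls `KLRegimeEngineV11`
(stmt-…-19823), `KLRegimeBetaSplitV11` (19824), `KLRegimeCountertermV11` (19825), `KLRegimeVolumeLimitV11` (19826) and
`KLRegimeTwoPointAssemblyV11` (19827) imply the leaf `H1TwoPointLimitKLScaleD` (stmt-…-19419: control for ALL `0 < β ≤ e^{c/U²}` on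
`δ ∈ [0.10, 0.35]`) — p4's generic `leaf_of_childrenP4` at `Pr := klPredsV11`, `VL := FinalTwoLegVolLimit` (the children carry no
lower bound `e^{a/U} ≤ β`; the corner `β ≤ klBetaMin` is the closed compact-box item R0′). Pure logic.
[cite: BenfattoGiulianiMastropietro2006, Thm 1.1] -/
theorem leaf_of_childrenV11 (h₃ : KLRegimeEngineV11) (h₁ : KLRegimeBetaSplitV11) (h₂ : KLRegimeCountertermV11)
    (h₅ : KLRegimeVolumeLimitV11) (h₄ : KLRegimeTwoPointAssemblyV11) : H1TwoPointLimitKLScaleD :=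
  leaf_of_childrenP4 (Pr := klPredsV11) (VL := FinalTwoLegVolLimit) h₃ h₁ h₂ h₅ h₄

/-- **The five gen-3 children give crux K3 `KLRegimeTwoPointLimit`** — the registered glue (stmt-…-19828) in curried form, recorded
here only so that §4 reads by name (`KLRegimeInductionV11P4`, seat k3c2-p3's module). [cite: BenfattoGiulianiMastropietro2006, Thm 1.1] -/
theorem klRegime_of_childrenV11 (h₃ : KLRegimeEngineV11) (h₁ : KLRegimeBetaSplitV11) (h₂ : KLRegimeCountertermV11)
    (h₅ : KLRegimeVolumeLimitV11) (h₄ : KLRegimeTwoPointAssemblyV11) : KLRegimeTwoPointLimit :=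
  KLRegimeInductionV11P4 h₃ h₁ h₂ h₅ h₄

/-! ### §2 The loaded pair of rung R2d from the children and the certificate half -/

/-- **THE LOADED PAIR OF RUNG R2d from the five gen-3 children and the three window records** (cert form (A)):
`WcbcsKohnLuttingerB1g ∧ H1TwoPointLimitKLScaleD` BY NAME. [cite: RaghuKivelsonScalapino2010, §III Fig. 2] -/
theorem klPair_of_enclosures_of_childrenV11 (hA : klCertB1gWinA.EnclosuresB1g) (hB : klCertB1gWinB.EnclosuresB1g)
    (hC : klCertB1gWinC.EnclosuresB1g) (h₃ : KLRegimeEngineV11) (h₁ : KLRegimeBetaSplitV11)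
    (h₂ : KLRegimeCountertermV11) (h₅ : KLRegimeVolumeLimitV11) (h₄ : KLRegimeTwoPointAssemblyV11) :
    WcbcsKohnLuttingerB1g ∧ H1TwoPointLimitKLScaleD :=
  klPair_of_enclosures_of_leaf hA hB hC (leaf_of_childrenV11 h₃ h₁ h₂ h₅ h₄)

/-- **The loaded pair on the EXTENDED common doping window `δ ∈ [0.10, 0.25]` from the children**, one set of constants
`(U₀, c, γ)` (`γ = 16905/1048576`, `U₀ ≤ 1`; records `Z, A, B, C`): selection `channelInf ε₀ μ(δ) U B1g + γU² ≤ channelInf ε₀ μ(δ) U χ`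
for `U ∈ (0, U₀)`, `χ ≠ B1g`, and control of the thermal two-point functions at `μ(δ)` for `0 < U ≤ U₀`, `0 < β ≤ e^{c/U²}`.
[cite: RaghuKivelsonScalapino2010, §III Fig. 2] -/
theorem klPair_doping_d010_d025_of_childrenV11 (hZ : klCertB1gWinZ.EnclosuresB1g) (hA : klCertB1gWinA.EnclosuresB1g)
    (hB : klCertB1gWinB.EnclosuresB1g) (hC : klCertB1gWinC.EnclosuresB1g) (h₃ : KLRegimeEngineV11)
    (h₁ : KLRegimeBetaSplitV11) (h₂ : KLRegimeCountertermV11) (h₅ : KLRegimeVolumeLimitV11)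
    (h₄ : KLRegimeTwoPointAssemblyV11) :
    ∃ U₀ c γ : ℝ, 0 < U₀ ∧ 0 < c ∧ 0 < γ ∧ ∀ δ ∈ Set.Icc (0.10 : ℝ) 0.25,
      (∀ U ∈ Set.Ioo (0 : ℝ) U₀, ∀ χ : D4Irrep, χ ≠ D4Irrep.B1g →
        channelInf (squareDispersion 1 0) (chemicalPotentialOfDensity (squareDispersion 1 0) (1 - δ)) U D4Irrep.B1g +
            γ * U ^ 2 ≤
          channelInf (squareDispersion 1 0) (chemicalPotentialOfDensity (squareDispersion 1 0) (1 - δ)) U χ) ∧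
      (∀ U β : ℝ, 0 < U → U ≤ U₀ → 0 < β → β ≤ Real.exp (c / U ^ 2) →
        ∀ (x y : Site 2) (σ σ' : Fin 2), ∃ S : ℂ,
          Tendsto (fun L : ℕ => hubbardThermalTwoPoint β U
            (chemicalPotentialOfDensity (squareDispersion 1 0) (1 - δ)) L x y σ σ') atTop (𝓝 S)) :=
  klPair_doping_d010_d025' hZ hA hB hC (leaf_of_childrenV11 h₃ h₁ h₂ h₅ h₄)

/-! ### §3 The H3 doors from the children with the weakest bridge `hBr` -/

/-- **THE CHILDREN DOOR: five gen-3 children + certificate + «(M_loc | normal-phase control)» + crux 2 ⇒ the summit.**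
Hypotheses: the five registered children of K3 BY NAME, the three window enclosure records (cert form (A)), gen 0's relativised
research stub `hBr` VERBATIM (the weakest bridge shape: normal-phase control for all `β ≤ e^{c/U²}` on the window is GIVEN to
stage 2), crux 2 `WcbcsSsbToTorusLRO` BY NAME.  Proof: §1, then `…Door`'s leaf door. Every binder is load-bearing.
[cite: KomaTasaki1994, §1] -/
theorem hubbardSuperconductivity_of_childrenV11_of_klMechanismRel_of_ssbToTorusLRO
    (h₃ : KLRegimeEngineV11) (h₁ : KLRegimeBetaSplitV11) (h₂ : KLRegimeCountertermV11) (h₅ : KLRegimeVolumeLimitV11)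
    (h₄ : KLRegimeTwoPointAssemblyV11)
    (hA : klCertB1gWinA.EnclosuresB1g) (hB : klCertB1gWinB.EnclosuresB1g) (hC : klCertB1gWinC.EnclosuresB1g)
    (hBr : ∀ μ₁ μ₂ γ U₁ U₀ c : ℝ, -2 ≤ μ₁ → μ₁ < μ₂ → μ₂ ≤ -(3:ℝ) / 10 → 0 < γ → 0 < U₁ → 0 < U₀ → 0 < c →
      (∀ μ ∈ Set.Icc μ₁ μ₂, ∀ U β : ℝ, 0 < U → U ≤ U₀ → 0 < β → β ≤ Real.exp (c / U ^ 2) →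
        ∀ (x y : Site 2) (σ σ' : Fin 2), ∃ S : ℂ,
          Tendsto (fun L : ℕ => hubbardThermalTwoPoint β U μ L x y σ σ') atTop (𝓝 S)) →
      (∀ U ∈ Set.Ioo (0:ℝ) U₁, ∀ μ ∈ Set.Icc μ₁ μ₂, ∀ χ : D4Irrep, χ ≠ D4Irrep.B1g →
        channelInf (squareDispersion 1 0) μ U D4Irrep.B1g + γ * U ^ 2 ≤ channelInf (squareDispersion 1 0) μ U χ) →
      ∃ U₀' C : ℝ, 0 < U₀' ∧ 0 < C ∧ ∀ U ∈ Set.Ioo (0:ℝ) U₀', ∀ μ ∈ Set.Icc (μ₁ + U / 2) μ₂,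
        Real.exp (-C / U ^ 2) ≤ dWaveOrderParameter U μ)
    (h2 : WcbcsSsbToTorusLRO) : _root_.HubbardSuperconductivity :=
  hubbardSuperconductivity_of_klPair_of_klMechanismRel_of_ssbToTorusLRO (leaf_of_childrenV11 h₃ h₁ h₂ h₅ h₄) hA hB hC hBr h2

/-- **The thin crux from the children, the certificate and `hBr`** (no crux 2). [cite: KomaTasaki1994, §1] -/
theorem thinCrux_of_childrenV11_of_klMechanismRel
    (h₃ : KLRegimeEngineV11) (h₁ : KLRegimeBetaSplitV11) (h₂ : KLRegimeCountertermV11) (h₅ : KLRegimeVolumeLimitV11)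
    (h₄ : KLRegimeTwoPointAssemblyV11)
    (hA : klCertB1gWinA.EnclosuresB1g) (hB : klCertB1gWinB.EnclosuresB1g) (hC : klCertB1gWinC.EnclosuresB1g)
    (hBr : ∀ μ₁ μ₂ γ U₁ U₀ c : ℝ, -2 ≤ μ₁ → μ₁ < μ₂ → μ₂ ≤ -(3:ℝ) / 10 → 0 < γ → 0 < U₁ → 0 < U₀ → 0 < c →
      (∀ μ ∈ Set.Icc μ₁ μ₂, ∀ U β : ℝ, 0 < U → U ≤ U₀ → 0 < β → β ≤ Real.exp (c / U ^ 2) →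
        ∀ (x y : Site 2) (σ σ' : Fin 2), ∃ S : ℂ,
          Tendsto (fun L : ℕ => hubbardThermalTwoPoint β U μ L x y σ σ') atTop (𝓝 S)) →
      (∀ U ∈ Set.Ioo (0:ℝ) U₁, ∀ μ ∈ Set.Icc μ₁ μ₂, ∀ χ : D4Irrep, χ ≠ D4Irrep.B1g →
        channelInf (squareDispersion 1 0) μ U D4Irrep.B1g + γ * U ^ 2 ≤ channelInf (squareDispersion 1 0) μ U χ) →
      ∃ U₀' C : ℝ, 0 < U₀' ∧ 0 < C ∧ ∀ U ∈ Set.Ioo (0:ℝ) U₀', ∀ μ ∈ Set.Icc (μ₁ + U / 2) μ₂,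
        Real.exp (-C / U ^ 2) ≤ dWaveOrderParameter U μ) :
    ∀ U₁ : ℝ, 0 < U₁ → ∃ U ∈ Set.Ioo (0:ℝ) U₁, ∃ δ ∈ Set.Ioo (0:ℝ) (1 / 2), ∃ μ : ℝ,
      Tendsto (fun L : ℕ => ((hubbardTorusWith 2 (L + 1) 1 U μ).groundStateFunctional
        totalNumber).re / ((L + 1 : ℕ) : ℝ) ^ 2) atTop (𝓝 (1 - δ)) ∧ HasDWaveOrder U μ :=
  thinCrux_of_klPair_of_klMechanismRel (leaf_of_childrenV11 h₃ h₁ h₂ h₅ h₄) hA hB hC hBr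

/-- **The rate-keeping crux (LINE-STATUS form (b)) from the children, the certificate and `hBr`** — no (D_loc), no crux 2.
[cite: KomaTasaki1994, §1] -/
theorem rateKeepingCrux_of_childrenV11_of_klMechanismRel
    (h₃ : KLRegimeEngineV11) (h₁ : KLRegimeBetaSplitV11) (h₂ : KLRegimeCountertermV11) (h₅ : KLRegimeVolumeLimitV11)
    (h₄ : KLRegimeTwoPointAssemblyV11)
    (hA : klCertB1gWinA.EnclosuresB1g) (hB : klCertB1gWinB.EnclosuresB1g) (hC : klCertB1gWinC.EnclosuresB1g)
    (hBr : ∀ μ₁ μ₂ γ U₁ U₀ c : ℝ, -2 ≤ μ₁ → μ₁ < μ₂ → μ₂ ≤ -(3:ℝ) / 10 → 0 < γ → 0 < U₁ → 0 < U₀ → 0 < c →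
      (∀ μ ∈ Set.Icc μ₁ μ₂, ∀ U β : ℝ, 0 < U → U ≤ U₀ → 0 < β → β ≤ Real.exp (c / U ^ 2) →
        ∀ (x y : Site 2) (σ σ' : Fin 2), ∃ S : ℂ,
          Tendsto (fun L : ℕ => hubbardThermalTwoPoint β U μ L x y σ σ') atTop (𝓝 S)) →
      (∀ U ∈ Set.Ioo (0:ℝ) U₁, ∀ μ ∈ Set.Icc μ₁ μ₂, ∀ χ : D4Irrep, χ ≠ D4Irrep.B1g →
        channelInf (squareDispersion 1 0) μ U D4Irrep.B1g + γ * U ^ 2 ≤ channelInf (squareDispersion 1 0) μ U χ) →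
      ∃ U₀' C : ℝ, 0 < U₀' ∧ 0 < C ∧ ∀ U ∈ Set.Ioo (0:ℝ) U₀', ∀ μ ∈ Set.Icc (μ₁ + U / 2) μ₂,
        Real.exp (-C / U ^ 2) ≤ dWaveOrderParameter U μ) :
    ∃ U₀ : ℝ, 0 < U₀ ∧ ∃ C : ℝ, 0 < C ∧ ∀ U ∈ Set.Ioo (0:ℝ) U₀, ∃ δ ∈ Set.Ioo (0:ℝ) (1 / 2), ∃ μ : ℝ,
      Tendsto (fun L : ℕ => ((hubbardTorusWith 2 (L + 1) 1 U μ).groundStateFunctional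
        totalNumber).re / ((L + 1 : ℕ) : ℝ) ^ 2) atTop (𝓝 (1 - δ)) ∧
      Real.exp (-C / U ^ 2) ≤ dWaveOrderParameter U μ :=
  rateKeepingCrux_of_klPair_of_klMechanismRel (leaf_of_childrenV11 h₃ h₁ h₂ h₅ h₄) hA hB hC hBr

/-- **The TYPED crux 4 `WcbcsBcsConstruction` BY NAME from the children, the certificate, `hBr` and (D_loc)** (`hD` = the registered
no-density-jump stub of stmt-…-2010 VERBATIM). [cite: KomaTasaki1994, §1] -/
theorem wcbcsBcsConstruction_of_childrenV11_of_klMechanismRel_of_noDensityJump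
    (h₃ : KLRegimeEngineV11) (h₁ : KLRegimeBetaSplitV11) (h₂ : KLRegimeCountertermV11) (h₅ : KLRegimeVolumeLimitV11)
    (h₄ : KLRegimeTwoPointAssemblyV11)
    (hA : klCertB1gWinA.EnclosuresB1g) (hB : klCertB1gWinB.EnclosuresB1g) (hC : klCertB1gWinC.EnclosuresB1g)
    (hBr : ∀ μ₁ μ₂ γ U₁ U₀ c : ℝ, -2 ≤ μ₁ → μ₁ < μ₂ → μ₂ ≤ -(3:ℝ) / 10 → 0 < γ → 0 < U₁ → 0 < U₀ → 0 < c →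
      (∀ μ ∈ Set.Icc μ₁ μ₂, ∀ U β : ℝ, 0 < U → U ≤ U₀ → 0 < β → β ≤ Real.exp (c / U ^ 2) →
        ∀ (x y : Site 2) (σ σ' : Fin 2), ∃ S : ℂ,
          Tendsto (fun L : ℕ => hubbardThermalTwoPoint β U μ L x y σ σ') atTop (𝓝 S)) →
      (∀ U ∈ Set.Ioo (0:ℝ) U₁, ∀ μ ∈ Set.Icc μ₁ μ₂, ∀ χ : D4Irrep, χ ≠ D4Irrep.B1g →
        channelInf (squareDispersion 1 0) μ U D4Irrep.B1g + γ * U ^ 2 ≤ channelInf (squareDispersion 1 0) μ U χ) →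
      ∃ U₀' C : ℝ, 0 < U₀' ∧ 0 < C ∧ ∀ U ∈ Set.Ioo (0:ℝ) U₀', ∀ μ ∈ Set.Icc (μ₁ + U / 2) μ₂,
        Real.exp (-C / U ^ 2) ≤ dWaveOrderParameter U μ)
    (hD : ∀ μ₁ μ₂ : ℝ, -2 ≤ μ₁ → μ₁ < μ₂ → μ₂ ≤ -(3:ℝ) / 10 → ∃ U_J : ℝ, 0 < U_J ∧ ∀ U ∈ Set.Ioo (0:ℝ) U_J,
      ∀ ν ∈ Set.Icc μ₁ μ₂, ∀ ε > 0, ∃ h > 0, ∃ᶠ L : ℕ in atTop,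
        ((hubbardTorusWith 2 (L + 1) 1 U (ν + h)).groundStateFunctional totalNumber).re / ((L + 1 : ℕ) : ℝ) ^ 2 -
          ((hubbardTorusWith 2 (L + 1) 1 U (ν - h)).groundStateFunctional totalNumber).re / ((L + 1 : ℕ) : ℝ) ^ 2 ≤ ε) :
    WcbcsBcsConstruction :=
  wcbcsBcsConstruction_of_klPair_of_klMechanismRel_of_noDensityJump (leaf_of_childrenV11 h₃ h₁ h₂ h₅ h₄) hA hB hC hBr hD

/-! ### §4 The same four through K3 and `hBrKL` (for comparison with `…KLRegimeDoor`) -/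

/-- **The children door through K3: five gen-3 children + certificate + «(M_loc | KL-regime control)» + crux 2 ⇒ the summit**
(§1's `klRegime_of_childrenV11`, then `…KLRegimeDoor`; `hBrKL` VERBATIM). [cite: KomaTasaki1994, §1] -/
theorem hubbardSuperconductivity_of_childrenV11_of_klMechanismRelKL_of_ssbToTorusLRO
    (h₃ : KLRegimeEngineV11) (h₁ : KLRegimeBetaSplitV11) (h₂ : KLRegimeCountertermV11) (h₅ : KLRegimeVolumeLimitV11)
    (h₄ : KLRegimeTwoPointAssemblyV11)
    (hA : klCertB1gWinA.EnclosuresB1g) (hB : klCertB1gWinB.EnclosuresB1g) (hC : klCertB1gWinC.EnclosuresB1g)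
    (hBrKL : ∀ μ₁ μ₂ γ U₁ : ℝ, -2 ≤ μ₁ → μ₁ < μ₂ → μ₂ ≤ -(3:ℝ) / 10 → 0 < γ → 0 < U₁ →
      (∀ a : ℝ, 0 < a → ∃ U₀ c : ℝ, 0 < U₀ ∧ 0 < c ∧ ∀ μ ∈ Set.Icc μ₁ μ₂, ∀ U β : ℝ, 0 < U → U ≤ U₀ →
        Real.exp (a / U) ≤ β → β ≤ Real.exp (c / U ^ 2) → ∀ (x y : Site 2) (σ σ' : Fin 2), ∃ S : ℂ,
          Tendsto (fun L : ℕ => hubbardThermalTwoPoint β U μ L x y σ σ') atTop (𝓝 S)) →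
      (∀ U ∈ Set.Ioo (0:ℝ) U₁, ∀ μ ∈ Set.Icc μ₁ μ₂, ∀ χ : D4Irrep, χ ≠ D4Irrep.B1g →
        channelInf (squareDispersion 1 0) μ U D4Irrep.B1g + γ * U ^ 2 ≤ channelInf (squareDispersion 1 0) μ U χ) →
      ∃ U₀' C : ℝ, 0 < U₀' ∧ 0 < C ∧ ∀ U ∈ Set.Ioo (0:ℝ) U₀', ∀ μ ∈ Set.Icc (μ₁ + U / 2) μ₂,
        Real.exp (-C / U ^ 2) ≤ dWaveOrderParameter U μ)
    (h2 : WcbcsSsbToTorusLRO) : _root_.HubbardSuperconductivity :=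
  hubbardSuperconductivity_of_klRegime_of_klMechanismRelKL_of_ssbToTorusLRO (klRegime_of_childrenV11 h₃ h₁ h₂ h₅ h₄)
    hA hB hC hBrKL h2

/-- **The thin crux from the children through K3 and `hBrKL`.** [cite: KomaTasaki1994, §1] -/
theorem thinCrux_of_childrenV11_of_klMechanismRelKL
    (h₃ : KLRegimeEngineV11) (h₁ : KLRegimeBetaSplitV11) (h₂ : KLRegimeCountertermV11) (h₅ : KLRegimeVolumeLimitV11)
    (h₄ : KLRegimeTwoPointAssemblyV11)
    (hA : klCertB1gWinA.EnclosuresB1g) (hB : klCertB1gWinB.EnclosuresB1g) (hC : klCertB1gWinC.EnclosuresB1g)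
    (hBrKL : ∀ μ₁ μ₂ γ U₁ : ℝ, -2 ≤ μ₁ → μ₁ < μ₂ → μ₂ ≤ -(3:ℝ) / 10 → 0 < γ → 0 < U₁ →
      (∀ a : ℝ, 0 < a → ∃ U₀ c : ℝ, 0 < U₀ ∧ 0 < c ∧ ∀ μ ∈ Set.Icc μ₁ μ₂, ∀ U β : ℝ, 0 < U → U ≤ U₀ →
        Real.exp (a / U) ≤ β → β ≤ Real.exp (c / U ^ 2) → ∀ (x y : Site 2) (σ σ' : Fin 2), ∃ S : ℂ,
          Tendsto (fun L : ℕ => hubbardThermalTwoPoint β U μ L x y σ σ') atTop (𝓝 S)) →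
      (∀ U ∈ Set.Ioo (0:ℝ) U₁, ∀ μ ∈ Set.Icc μ₁ μ₂, ∀ χ : D4Irrep, χ ≠ D4Irrep.B1g →
        channelInf (squareDispersion 1 0) μ U D4Irrep.B1g + γ * U ^ 2 ≤ channelInf (squareDispersion 1 0) μ U χ) →
      ∃ U₀' C : ℝ, 0 < U₀' ∧ 0 < C ∧ ∀ U ∈ Set.Ioo (0:ℝ) U₀', ∀ μ ∈ Set.Icc (μ₁ + U / 2) μ₂,
        Real.exp (-C / U ^ 2) ≤ dWaveOrderParameter U μ) :
    ∀ U₁ : ℝ, 0 < U₁ → ∃ U ∈ Set.Ioo (0:ℝ) U₁, ∃ δ ∈ Set.Ioo (0:ℝ) (1 / 2), ∃ μ : ℝ,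
      Tendsto (fun L : ℕ => ((hubbardTorusWith 2 (L + 1) 1 U μ).groundStateFunctional
        totalNumber).re / ((L + 1 : ℕ) : ℝ) ^ 2) atTop (𝓝 (1 - δ)) ∧ HasDWaveOrder U μ :=
  thinCrux_of_klRegime_of_klMechanismRelKL (klRegime_of_childrenV11 h₃ h₁ h₂ h₅ h₄) hA hB hC hBrKL

/-- **The rate-keeping crux from the children through K3 and `hBrKL`** — no (D_loc), no crux 2. [cite: KomaTasaki1994, §1] -/
theorem rateKeepingCrux_of_childrenV11_of_klMechanismRelKL
    (h₃ : KLRegimeEngineV11) (h₁ : KLRegimeBetaSplitV11) (h₂ : KLRegimeCountertermV11) (h₅ : KLRegimeVolumeLimitV11)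
    (h₄ : KLRegimeTwoPointAssemblyV11)
    (hA : klCertB1gWinA.EnclosuresB1g) (hB : klCertB1gWinB.EnclosuresB1g) (hC : klCertB1gWinC.EnclosuresB1g)
    (hBrKL : ∀ μ₁ μ₂ γ U₁ : ℝ, -2 ≤ μ₁ → μ₁ < μ₂ → μ₂ ≤ -(3:ℝ) / 10 → 0 < γ → 0 < U₁ →
      (∀ a : ℝ, 0 < a → ∃ U₀ c : ℝ, 0 < U₀ ∧ 0 < c ∧ ∀ μ ∈ Set.Icc μ₁ μ₂, ∀ U β : ℝ, 0 < U → U ≤ U₀ →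
        Real.exp (a / U) ≤ β → β ≤ Real.exp (c / U ^ 2) → ∀ (x y : Site 2) (σ σ' : Fin 2), ∃ S : ℂ,
          Tendsto (fun L : ℕ => hubbardThermalTwoPoint β U μ L x y σ σ') atTop (𝓝 S)) →
      (∀ U ∈ Set.Ioo (0:ℝ) U₁, ∀ μ ∈ Set.Icc μ₁ μ₂, ∀ χ : D4Irrep, χ ≠ D4Irrep.B1g →
        channelInf (squareDispersion 1 0) μ U D4Irrep.B1g + γ * U ^ 2 ≤ channelInf (squareDispersion 1 0) μ U χ) →
      ∃ U₀' C : ℝ, 0 < U₀' ∧ 0 < C ∧ ∀ U ∈ Set.Ioo (0:ℝ) U₀', ∀ μ ∈ Set.Icc (μ₁ + U / 2) μ₂,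
        Real.exp (-C / U ^ 2) ≤ dWaveOrderParameter U μ) :
    ∃ U₀ : ℝ, 0 < U₀ ∧ ∃ C : ℝ, 0 < C ∧ ∀ U ∈ Set.Ioo (0:ℝ) U₀, ∃ δ ∈ Set.Ioo (0:ℝ) (1 / 2), ∃ μ : ℝ,
      Tendsto (fun L : ℕ => ((hubbardTorusWith 2 (L + 1) 1 U μ).groundStateFunctional
        totalNumber).re / ((L + 1 : ℕ) : ℝ) ^ 2) atTop (𝓝 (1 - δ)) ∧
      Real.exp (-C / U ^ 2) ≤ dWaveOrderParameter U μ :=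
  rateKeepingCrux_of_klRegime_of_klMechanismRelKL (klRegime_of_childrenV11 h₃ h₁ h₂ h₅ h₄) hA hB hC hBrKL

/-- **The typed crux 4 from the children through K3, `hBrKL` and (D_loc).** [cite: KomaTasaki1994, §1] -/
theorem wcbcsBcsConstruction_of_childrenV11_of_klMechanismRelKL_of_noDensityJump
    (h₃ : KLRegimeEngineV11) (h₁ : KLRegimeBetaSplitV11) (h₂ : KLRegimeCountertermV11) (h₅ : KLRegimeVolumeLimitV11)
    (h₄ : KLRegimeTwoPointAssemblyV11)
    (hA : klCertB1gWinA.EnclosuresB1g) (hB : klCertB1gWinB.EnclosuresB1g) (hC : klCertB1gWinC.EnclosuresB1g)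
    (hBrKL : ∀ μ₁ μ₂ γ U₁ : ℝ, -2 ≤ μ₁ → μ₁ < μ₂ → μ₂ ≤ -(3:ℝ) / 10 → 0 < γ → 0 < U₁ →
      (∀ a : ℝ, 0 < a → ∃ U₀ c : ℝ, 0 < U₀ ∧ 0 < c ∧ ∀ μ ∈ Set.Icc μ₁ μ₂, ∀ U β : ℝ, 0 < U → U ≤ U₀ →
        Real.exp (a / U) ≤ β → β ≤ Real.exp (c / U ^ 2) → ∀ (x y : Site 2) (σ σ' : Fin 2), ∃ S : ℂ,
          Tendsto (fun L : ℕ => hubbardThermalTwoPoint β U μ L x y σ σ') atTop (𝓝 S)) →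
      (∀ U ∈ Set.Ioo (0:ℝ) U₁, ∀ μ ∈ Set.Icc μ₁ μ₂, ∀ χ : D4Irrep, χ ≠ D4Irrep.B1g →
        channelInf (squareDispersion 1 0) μ U D4Irrep.B1g + γ * U ^ 2 ≤ channelInf (squareDispersion 1 0) μ U χ) →
      ∃ U₀' C : ℝ, 0 < U₀' ∧ 0 < C ∧ ∀ U ∈ Set.Ioo (0:ℝ) U₀', ∀ μ ∈ Set.Icc (μ₁ + U / 2) μ₂,
        Real.exp (-C / U ^ 2) ≤ dWaveOrderParameter U μ)
    (hD : ∀ μ₁ μ₂ : ℝ, -2 ≤ μ₁ → μ₁ < μ₂ → μ₂ ≤ -(3:ℝ) / 10 → ∃ U_J : ℝ, 0 < U_J ∧ ∀ U ∈ Set.Ioo (0:ℝ) U_J,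
      ∀ ν ∈ Set.Icc μ₁ μ₂, ∀ ε > 0, ∃ h > 0, ∃ᶠ L : ℕ in atTop,
        ((hubbardTorusWith 2 (L + 1) 1 U (ν + h)).groundStateFunctional totalNumber).re / ((L + 1 : ℕ) : ℝ) ^ 2 -
          ((hubbardTorusWith 2 (L + 1) 1 U (ν - h)).groundStateFunctional totalNumber).re / ((L + 1 : ℕ) : ℝ) ^ 2 ≤ ε) :
    WcbcsBcsConstruction :=
  wcbcsBcsConstruction_of_klRegime_of_klMechanismRelKL_of_noDensityJump (klRegime_of_childrenV11 h₃ h₁ h₂ h₅ h₄)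
    hA hB hC hBrKL hD

/-! ### §5 (appended 2026-08-26, gen 3) After the closures of 2026-08-26 — children 1 and 4 PROVED (`klRegimeBetaSplitV11_proof`,
stmt-…-19824, seat k3c1-p2; `TwoPointAssembly.KLRegimeTwoPointAssemblyV11_of`, stmt-…-19827, seat k3c5-p1): the leaf, K3, the loaded
pair and the four doors from the THREE OPEN children `KLRegimeEngineV11` (19823) · `KLRegimeCountertermV11` (19825) ·
`KLRegimeVolumeLimitV11` (19826) BY NAME -/

/-- **THE RUNG-R2d THEOREM HALF FROM THE THREE OPEN CHILDREN** Engine (stmt-…-19823) · Counterterm (19825) · VolumeLimit (19826):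
children 1 (beta split) and 4 (two-point assembly) are theorems of the tree. [cite: BenfattoGiulianiMastropietro2006, Thm 1.1] -/
theorem leaf_of_openChildrenV11 (h₃ : KLRegimeEngineV11) (h₂ : KLRegimeCountertermV11) (h₅ : KLRegimeVolumeLimitV11) :
    H1TwoPointLimitKLScaleD :=
  leaf_of_childrenV11 h₃ klRegimeBetaSplitV11_proof h₂ h₅ TwoPointAssembly.KLRegimeTwoPointAssemblyV11_of

/-- **Crux K3 from the three open children** (glue + the two landed closers). [cite: BenfattoGiulianiMastropietro2006, Thm 1.1] -/
theorem klRegime_of_openChildrenV11 (h₃ : KLRegimeEngineV11) (h₂ : KLRegimeCountertermV11) (h₅ : KLRegimeVolumeLimitV11) :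
    KLRegimeTwoPointLimit :=
  klRegime_of_childrenV11 h₃ klRegimeBetaSplitV11_proof h₂ h₅ TwoPointAssembly.KLRegimeTwoPointAssemblyV11_of

/-- **The loaded pair on `δ ∈ [0.10, 0.25]` from the three open children and the four window records** (one `(U₀, c, γ)`).
[cite: RaghuKivelsonScalapino2010, §III Fig. 2] -/
theorem klPair_doping_d010_d025_of_openChildrenV11 (hZ : klCertB1gWinZ.EnclosuresB1g) (hA : klCertB1gWinA.EnclosuresB1g)
    (hB : klCertB1gWinB.EnclosuresB1g) (hC : klCertB1gWinC.EnclosuresB1g) (h₃ : KLRegimeEngineV11)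
    (h₂ : KLRegimeCountertermV11) (h₅ : KLRegimeVolumeLimitV11) :
    ∃ U₀ c γ : ℝ, 0 < U₀ ∧ 0 < c ∧ 0 < γ ∧ ∀ δ ∈ Set.Icc (0.10 : ℝ) 0.25,
      (∀ U ∈ Set.Ioo (0 : ℝ) U₀, ∀ χ : D4Irrep, χ ≠ D4Irrep.B1g →
        channelInf (squareDispersion 1 0) (chemicalPotentialOfDensity (squareDispersion 1 0) (1 - δ)) U D4Irrep.B1g +
            γ * U ^ 2 ≤
          channelInf (squareDispersion 1 0) (chemicalPotentialOfDensity (squareDispersion 1 0) (1 - δ)) U χ) ∧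
      (∀ U β : ℝ, 0 < U → U ≤ U₀ → 0 < β → β ≤ Real.exp (c / U ^ 2) →
        ∀ (x y : Site 2) (σ σ' : Fin 2), ∃ S : ℂ,
          Tendsto (fun L : ℕ => hubbardThermalTwoPoint β U
            (chemicalPotentialOfDensity (squareDispersion 1 0) (1 - δ)) L x y σ σ') atTop (𝓝 S)) :=
  klPair_doping_d010_d025_of_childrenV11 hZ hA hB hC h₃ klRegimeBetaSplitV11_proof h₂ h₅
    TwoPointAssembly.KLRegimeTwoPointAssemblyV11_of

/-- **THE DOOR FROM THE THREE OPEN CHILDREN: Engine · Counterterm · VolumeLimit + certificate + «(M_loc | normal-phase control)»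
+ crux 2 ⇒ the summit.**  What stands between the KL programme as registered TODAY and `HubbardSuperconductivity`, by name:
three open children of K3, the relativised (M_loc) `hBr`, crux 2 `WcbcsSsbToTorusLRO` (the window records are the VERIFIED
certificate half, form (A)). [cite: KomaTasaki1994, §1] -/
theorem hubbardSuperconductivity_of_openChildrenV11_of_klMechanismRel_of_ssbToTorusLRO
    (h₃ : KLRegimeEngineV11) (h₂ : KLRegimeCountertermV11) (h₅ : KLRegimeVolumeLimitV11)
    (hA : klCertB1gWinA.EnclosuresB1g) (hB : klCertB1gWinB.EnclosuresB1g) (hC : klCertB1gWinC.EnclosuresB1g)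
    (hBr : ∀ μ₁ μ₂ γ U₁ U₀ c : ℝ, -2 ≤ μ₁ → μ₁ < μ₂ → μ₂ ≤ -(3:ℝ) / 10 → 0 < γ → 0 < U₁ → 0 < U₀ → 0 < c →
      (∀ μ ∈ Set.Icc μ₁ μ₂, ∀ U β : ℝ, 0 < U → U ≤ U₀ → 0 < β → β ≤ Real.exp (c / U ^ 2) →
        ∀ (x y : Site 2) (σ σ' : Fin 2), ∃ S : ℂ,
          Tendsto (fun L : ℕ => hubbardThermalTwoPoint β U μ L x y σ σ') atTop (𝓝 S)) →
      (∀ U ∈ Set.Ioo (0:ℝ) U₁, ∀ μ ∈ Set.Icc μ₁ μ₂, ∀ χ : D4Irrep, χ ≠ D4Irrep.B1g →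
        channelInf (squareDispersion 1 0) μ U D4Irrep.B1g + γ * U ^ 2 ≤ channelInf (squareDispersion 1 0) μ U χ) →
      ∃ U₀' C : ℝ, 0 < U₀' ∧ 0 < C ∧ ∀ U ∈ Set.Ioo (0:ℝ) U₀', ∀ μ ∈ Set.Icc (μ₁ + U / 2) μ₂,
        Real.exp (-C / U ^ 2) ≤ dWaveOrderParameter U μ)
    (h2 : WcbcsSsbToTorusLRO) : _root_.HubbardSuperconductivity :=
  hubbardSuperconductivity_of_childrenV11_of_klMechanismRel_of_ssbToTorusLRO h₃ klRegimeBetaSplitV11_proof h₂ h₅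
    TwoPointAssembly.KLRegimeTwoPointAssemblyV11_of hA hB hC hBr h2

/-- **The thin crux from the three open children, the certificate and `hBr`.** [cite: KomaTasaki1994, §1] -/
theorem thinCrux_of_openChildrenV11_of_klMechanismRel
    (h₃ : KLRegimeEngineV11) (h₂ : KLRegimeCountertermV11) (h₅ : KLRegimeVolumeLimitV11)
    (hA : klCertB1gWinA.EnclosuresB1g) (hB : klCertB1gWinB.EnclosuresB1g) (hC : klCertB1gWinC.EnclosuresB1g)
    (hBr : ∀ μ₁ μ₂ γ U₁ U₀ c : ℝ, -2 ≤ μ₁ → μ₁ < μ₂ → μ₂ ≤ -(3:ℝ) / 10 → 0 < γ → 0 < U₁ → 0 < U₀ → 0 < c →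
      (∀ μ ∈ Set.Icc μ₁ μ₂, ∀ U β : ℝ, 0 < U → U ≤ U₀ → 0 < β → β ≤ Real.exp (c / U ^ 2) →
        ∀ (x y : Site 2) (σ σ' : Fin 2), ∃ S : ℂ,
          Tendsto (fun L : ℕ => hubbardThermalTwoPoint β U μ L x y σ σ') atTop (𝓝 S)) →
      (∀ U ∈ Set.Ioo (0:ℝ) U₁, ∀ μ ∈ Set.Icc μ₁ μ₂, ∀ χ : D4Irrep, χ ≠ D4Irrep.B1g →
        channelInf (squareDispersion 1 0) μ U D4Irrep.B1g + γ * U ^ 2 ≤ channelInf (squareDispersion 1 0) μ U χ) →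
      ∃ U₀' C : ℝ, 0 < U₀' ∧ 0 < C ∧ ∀ U ∈ Set.Ioo (0:ℝ) U₀', ∀ μ ∈ Set.Icc (μ₁ + U / 2) μ₂,
        Real.exp (-C / U ^ 2) ≤ dWaveOrderParameter U μ) :
    ∀ U₁ : ℝ, 0 < U₁ → ∃ U ∈ Set.Ioo (0:ℝ) U₁, ∃ δ ∈ Set.Ioo (0:ℝ) (1 / 2), ∃ μ : ℝ,
      Tendsto (fun L : ℕ => ((hubbardTorusWith 2 (L + 1) 1 U μ).groundStateFunctional
        totalNumber).re / ((L + 1 : ℕ) : ℝ) ^ 2) atTop (𝓝 (1 - δ)) ∧ HasDWaveOrder U μ :=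
  thinCrux_of_childrenV11_of_klMechanismRel h₃ klRegimeBetaSplitV11_proof h₂ h₅
    TwoPointAssembly.KLRegimeTwoPointAssemblyV11_of hA hB hC hBr

/-- **The rate-keeping crux from the three open children, the certificate and `hBr`** — no (D_loc), no crux 2.
[cite: KomaTasaki1994, §1] -/
theorem rateKeepingCrux_of_openChildrenV11_of_klMechanismRel
    (h₃ : KLRegimeEngineV11) (h₂ : KLRegimeCountertermV11) (h₅ : KLRegimeVolumeLimitV11)
    (hA : klCertB1gWinA.EnclosuresB1g) (hB : klCertB1gWinB.EnclosuresB1g) (hC : klCertB1gWinC.EnclosuresB1g)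
    (hBr : ∀ μ₁ μ₂ γ U₁ U₀ c : ℝ, -2 ≤ μ₁ → μ₁ < μ₂ → μ₂ ≤ -(3:ℝ) / 10 → 0 < γ → 0 < U₁ → 0 < U₀ → 0 < c →
      (∀ μ ∈ Set.Icc μ₁ μ₂, ∀ U β : ℝ, 0 < U → U ≤ U₀ → 0 < β → β ≤ Real.exp (c / U ^ 2) →
        ∀ (x y : Site 2) (σ σ' : Fin 2), ∃ S : ℂ,
          Tendsto (fun L : ℕ => hubbardThermalTwoPoint β U μ L x y σ σ') atTop (𝓝 S)) →
      (∀ U ∈ Set.Ioo (0:ℝ) U₁, ∀ μ ∈ Set.Icc μ₁ μ₂, ∀ χ : D4Irrep, χ ≠ D4Irrep.B1g →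
        channelInf (squareDispersion 1 0) μ U D4Irrep.B1g + γ * U ^ 2 ≤ channelInf (squareDispersion 1 0) μ U χ) →
      ∃ U₀' C : ℝ, 0 < U₀' ∧ 0 < C ∧ ∀ U ∈ Set.Ioo (0:ℝ) U₀', ∀ μ ∈ Set.Icc (μ₁ + U / 2) μ₂,
        Real.exp (-C / U ^ 2) ≤ dWaveOrderParameter U μ) :
    ∃ U₀ : ℝ, 0 < U₀ ∧ ∃ C : ℝ, 0 < C ∧ ∀ U ∈ Set.Ioo (0:ℝ) U₀, ∃ δ ∈ Set.Ioo (0:ℝ) (1 / 2), ∃ μ : ℝ,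
      Tendsto (fun L : ℕ => ((hubbardTorusWith 2 (L + 1) 1 U μ).groundStateFunctional
        totalNumber).re / ((L + 1 : ℕ) : ℝ) ^ 2) atTop (𝓝 (1 - δ)) ∧
      Real.exp (-C / U ^ 2) ≤ dWaveOrderParameter U μ :=
  rateKeepingCrux_of_childrenV11_of_klMechanismRel h₃ klRegimeBetaSplitV11_proof h₂ h₅
    TwoPointAssembly.KLRegimeTwoPointAssemblyV11_of hA hB hC hBr

/-- **The typed crux 4 from the three open children, the certificate, `hBr` and (D_loc).** [cite: KomaTasaki1994, §1] -/
theorem wcbcsBcsConstruction_of_openChildrenV11_of_klMechanismRel_of_noDensityJump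
    (h₃ : KLRegimeEngineV11) (h₂ : KLRegimeCountertermV11) (h₅ : KLRegimeVolumeLimitV11)
    (hA : klCertB1gWinA.EnclosuresB1g) (hB : klCertB1gWinB.EnclosuresB1g) (hC : klCertB1gWinC.EnclosuresB1g)
    (hBr : ∀ μ₁ μ₂ γ U₁ U₀ c : ℝ, -2 ≤ μ₁ → μ₁ < μ₂ → μ₂ ≤ -(3:ℝ) / 10 → 0 < γ → 0 < U₁ → 0 < U₀ → 0 < c →
      (∀ μ ∈ Set.Icc μ₁ μ₂, ∀ U β : ℝ, 0 < U → U ≤ U₀ → 0 < β → β ≤ Real.exp (c / U ^ 2) →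
        ∀ (x y : Site 2) (σ σ' : Fin 2), ∃ S : ℂ,
          Tendsto (fun L : ℕ => hubbardThermalTwoPoint β U μ L x y σ σ') atTop (𝓝 S)) →
      (∀ U ∈ Set.Ioo (0:ℝ) U₁, ∀ μ ∈ Set.Icc μ₁ μ₂, ∀ χ : D4Irrep, χ ≠ D4Irrep.B1g →
        channelInf (squareDispersion 1 0) μ U D4Irrep.B1g + γ * U ^ 2 ≤ channelInf (squareDispersion 1 0) μ U χ) →
      ∃ U₀' C : ℝ, 0 < U₀' ∧ 0 < C ∧ ∀ U ∈ Set.Ioo (0:ℝ) U₀', ∀ μ ∈ Set.Icc (μ₁ + U / 2) μ₂,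
        Real.exp (-C / U ^ 2) ≤ dWaveOrderParameter U μ)
    (hD : ∀ μ₁ μ₂ : ℝ, -2 ≤ μ₁ → μ₁ < μ₂ → μ₂ ≤ -(3:ℝ) / 10 → ∃ U_J : ℝ, 0 < U_J ∧ ∀ U ∈ Set.Ioo (0:ℝ) U_J,
      ∀ ν ∈ Set.Icc μ₁ μ₂, ∀ ε > 0, ∃ h > 0, ∃ᶠ L : ℕ in atTop,
        ((hubbardTorusWith 2 (L + 1) 1 U (ν + h)).groundStateFunctional totalNumber).re / ((L + 1 : ℕ) : ℝ) ^ 2 -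
          ((hubbardTorusWith 2 (L + 1) 1 U (ν - h)).groundStateFunctional totalNumber).re / ((L + 1 : ℕ) : ℝ) ^ 2 ≤ ε) :
    WcbcsBcsConstruction :=
  wcbcsBcsConstruction_of_childrenV11_of_klMechanismRel_of_noDensityJump h₃ klRegimeBetaSplitV11_proof h₂ h₅
    TwoPointAssembly.KLRegimeTwoPointAssemblyV11_of hA hB hC hBr hD

end Summit.HubbardSuperconductivity.HubbardSuperconductivity.Theorems.R2dH1

end
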